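import Summits.BirchSwinnertonDyer.BirchSwinnertonDyer.Theorems.Rank2ObservatoryConductorCertTate
import Summits.BirchSwinnertonDyer.BirchSwinnertonDyer.Theorems.Rank2ObservatoryRootNumberCert
import Summits.BirchSwinnertonDyer.BirchSwinnertonDyer.Theorems.Rank2ObservatoryRootNumberLocal
import Literature.NumberTheory.EllipticCurves.HondaStrongIsomorphismMultiplicativeProofs
import Literature.NumberTheory.EllipticCurves.NeronComponentIndexProofs
import Literature.NumberTheory.EllipticCurves.NeronComponentIndexTypeIIIProofs
import Literature.NumberTheory.EllipticCurves.NeronComponentIndexTypeIIIstarProofs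
import Literature.NumberTheory.EllipticCurves.NeronComponentIndexTypeIVProofs
import Literature.NumberTheory.EllipticCurves.NeronComponentIndexTypeIVstarProofs
import Literature.NumberTheory.EllipticCurves.NeronComponentIndexTypeI0starProofs
import Literature.NumberTheory.EllipticCurves.NeronComponentIndexTypeInstarProofs
import Literature.NumberTheory.EllipticCurves.NonsplitProofs
import Literature.NumberTheory.EllipticCurves.NeronComponentIndexSplitProofs
import Literature.NumberTheory.EllipticCurves.TamagawaSubgroupProofs
import Literature.NumberTheory.DiophantineGeometry.Conductor
import Mathlib.NumberTheory.Padics.HeightOneSpectrum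
import HarnessLib

/-!
# BSD rank ≥ 2 observatory (`b2b-bsdr2`, cert-2 gen 10): KERNEL CERTIFICATES of the local Tamagawa
# number `c_p` — part 1/3: reduction of an INTEGER EQUATION at a place of `𝓞 ℚ`

HONEST FRAMING: per-curve certified theorems and census instruments; no claim on BSD in rank ≥ 2.

Theorems only (no named fact, no axiom).  For an integer equation `W₀ : WeierstrassCurve ℤ` (the
curve being `W₀ ⊗ ℚ`) and a finite place `v` of `𝓞 ℚ` over the prime `p`, the local Tamagawa number
is the tree's `c_v = ((W₀ ⊗ ℚ) ⊗ ℚ_v).localTamagawaNumber O_v` (abbreviated `tam W₀ v`; it is the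
factor of `WeierstrassCurve.tamagawaProduct`, `Literature/NumberTheory/EllipticCurves/Tamagawa`).
This file ports to the places of `𝓞 ℚ` (the index of `tamagawaProduct` and of the cell's Tate
certificates `Tate.Step2Cert`, `Tate.DeepCert`) the `ℤ`-place reduction lemmas of the cell's
`Rank2ObservatoryRootNumberLocal`, for an ARBITRARY integer equation:

* `isIntegralAt_int`, `integralModel_int_adicCompletion` (the `O_v`-integral model is the cast of
  `W₀`), `isMinimalAt_int_of_not_dvd_c₄` (`p ∤ c₄ ⟹` minimal, *AEC* VII.1 Rem. 1.1),
  `ordMinimalDiscriminant_int_eq` (`pⁿ ∥ Δ(W₀)`, minimal `⟹ ord_v Δ_min = n`);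
* `tam_eq_one_of_not_dvd` (`p ∤ Δ(W₀) ⟹ c_v = 1`), `hasMultiplicativeReductionAt_int`
  (`p ∣ Δ`, `p ∤ c₄`), and `hasSplitMultiplicativeReductionAt_int_iff`: SPLIT multiplicative reduction
  at `v` iff the node-tangent quadratic `nodalPoly W₀ p = c₄T² + a₁c₄T − (54b₆ − 3b₂b₄ + a₂c₄) mod p`
  splits over `𝔽_p` (*AEC* VII.5 Prop. 5.1(b), model independence VII.1.3(b), `κ(v) ≃ ℤ/p`);
* kernel-decidable readings of that splitting: a root witness (`splits_nodalPoly_of_dvd`),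
  exhaustion of `t < p` (`not_splits_nodalPoly_of_forall`), an Euler witness on its discriminant
  (`not_splits_nodalPoly_of_euler`);
* `kodairaVals`: the value set of `c_v` the TREE PROVES for each additive Kodaira type
  (`II ↦ {1}`, `III ↦ {2}`, `IV ↦ {1,3}`, `I₀* ↦ {1,2,4}`, `Iₙ* ↦ {2,4}` (`n ≥ 1`), `IV* ↦ {1,3}`,
  `III* ↦ {2}`, `II* ↦ {1}` — Silverman *ATAEC* IV.9.4 Steps 3–10 as discharged in
  `Literature/NumberTheory/EllipticCurves/NeronComponentIndex*`), and `tam_mem_kodairaVals`.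

Parts 2/3 (`Rank2ObservatoryTamagawaLocal`: the local certificate `TamLocal` and its soundness) and
3/3 (`Rank2ObservatoryTamagawaCert`: row certificates and `tamagawaProduct`) build on it.

References: J. H. Silverman, *The Arithmetic of Elliptic Curves*, 2nd ed. (2009), VII.1 Rem. 1.1 and
Prop. 1.3, VII.5 Prop. 5.1 [SilvermanAEC2009]; J. H. Silverman, *Advanced Topics in the Arithmetic of
Elliptic Curves*, GTM 151 (1994), IV.9.4 [SilvermanATAEC1994] [Silverman1994].
-/

set_option linter.dupNamespace false
set_option autoImplicit false

open scoped NumberField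
open Polynomial IsLocalRing IsDedekindDomain Rat.HeightOneSpectrum WeierstrassCurve
  Literature.NumberTheory.EllipticCurves Literature.NumberTheory.GaloisRepresentations
  Literature.NumberTheory.DiophantineGeometry Literature.NumberTheory.DiophantineGeometry.TateAlgorithm
  Literature.NumberTheory.Sieve

namespace Summit.BirchSwinnertonDyer.BirchSwinnertonDyer.Rank2Observatory.Tam

open Tate
open Tate.Step2Cert (pdvd pexact pdvd_iff pexact_iff)

/-- The local Tamagawa number `c_v` of `W₀ ⊗ ℚ` at the finite place `v` of `𝓞 ℚ` — the factor of the
tree's `WeierstrassCurve.tamagawaProduct`. [folklore] -/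
noncomputable abbrev tam (W₀ : WeierstrassCurve ℤ) (v : HeightOneSpectrum (𝓞 ℚ)) : ℕ :=
  ((W₀.baseChange ℚ).baseChange (v.adicCompletion ℚ)).localTamagawaNumber (v.adicCompletionIntegers ℚ)

/-- The node-tangent quadratic `c₄T² + a₁c₄T − (54b₆ − 3b₂b₄ + a₂c₄)` of `W₀` modulo `p`.
[cite: SilvermanAEC2009, VII.5 Prop. 5.1(b)] -/
noncomputable def nodalPoly (W₀ : WeierstrassCurve ℤ) (p : ℕ) : Polynomial (ZMod p) :=
  letI I := W₀.map (Int.castRingHom (ZMod p))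
  C I.c₄ * X ^ 2 + C (I.a₁ * I.c₄) * X - C (54 * I.b₆ - 3 * I.b₂ * I.b₄ + I.a₂ * I.c₄)

/-! ### Reduction of an integer equation at a place of `𝓞 ℚ` -/

section IntModel

variable (W₀ : WeierstrassCurve ℤ) (v : HeightOneSpectrum (𝓞 ℚ))

/-- An integer equation is `v`-integral at every finite place `v` of `𝓞 ℚ`. [folklore] -/
theorem isIntegralAt_int : (W₀.baseChange ℚ).IsIntegralAt v := by
  refine ⟨⟨W₀.map (algebraMap ℤ (v.adicCompletionIntegers ℚ)), ?_⟩⟩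
  ext <;> simp [baseChange, WeierstrassCurve.map]

/-- Mathlib's chosen `O_v`-integral model of `W₀ ⊗ ℚ ⊗ ℚ_v` is `W₀` itself read in `O_v` (lifts along
`O_v ↪ ℚ_v` are unique). [folklore] -/
theorem integralModel_int_adicCompletion
    [IsIntegral (v.adicCompletionIntegers ℚ) ((W₀.baseChange ℚ).baseChange (v.adicCompletion ℚ))] :
    integralModel (v.adicCompletionIntegers ℚ) ((W₀.baseChange ℚ).baseChange (v.adicCompletion ℚ)) =
      W₀.map (Int.castRingHom (v.adicCompletionIntegers ℚ)) := by
  refine integralModel_eq_of_baseChange_eq _ _ ?_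
  ext <;> simp [baseChange, WeierstrassCurve.map]

variable {W₀ v}

/-- **Minimality at `v` from `p ∤ c₄(W₀)`** (Silverman *AEC* VII.1 Rem. 1.1). [cite: SilvermanAEC2009, VII.1 Remark 1.1] -/
theorem isMinimalAt_int_of_not_dvd_c₄ {p : ℕ} (hv : natGenerator v = p) (hc₄ : ¬ (p : ℤ) ∣ W₀.c₄) :
    (W₀.baseChange ℚ).IsMinimalAt v :=
  isMinimalAt_of_lt_valuation_c₄ (isIntegralAt_int W₀ v)
    (by rw [baseChange_int_c₄, Rat.valuation_intCast_eq_one v (by rw [hv]; exact hc₄), ← WithZero.exp_zero]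
        exact WithZero.exp_lt_exp.mpr (by norm_num))

/-- **`c_v = 1` at `p ∤ Δ(W₀)`**: unit discriminant gives good reduction (Silverman *AEC* VII.5.1(a)),
and `c_v = 1` at a good place (the tree's `localTamagawaNumber_eq_one_of_hasGoodReductionAt_holds`,
*AEC* VII.2, remark after 2.1). [cite: SilvermanAEC2009, VII.5 Prop. 5.1(a)] -/
theorem tam_eq_one_of_not_dvd [(W₀.baseChange ℚ).IsElliptic] {p : ℕ} (hv : natGenerator v = p)
    (hΔ : ¬ (p : ℤ) ∣ W₀.Δ) : tam W₀ v = 1 :=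
  (W₀.baseChange ℚ).localTamagawaNumber_eq_one_of_hasGoodReductionAt_holds v
    (hasGoodReductionAt_of_valuation_Δ_eq_one_holds (v := v) (W := W₀.baseChange ℚ)
      (isIntegralAt_int W₀ v)
      (by rw [baseChange_int_Δ]; exact Rat.valuation_intCast_eq_one v (by rw [hv]; exact hΔ)))

/-- **Multiplicative reduction from `p ∣ Δ(W₀)`, `p ∤ c₄(W₀)`** at the place of `𝓞 ℚ` over `p`
(Silverman *AEC* VII.5.1(b); the equation is minimal at `p`, VII.1 Rem. 1.1).
[cite: SilvermanAEC2009, VII.5 Prop. 5.1(b)] -/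
theorem hasMultiplicativeReductionAt_int [(W₀.baseChange ℚ).IsElliptic] {p : ℕ} (hv : natGenerator v = p)
    (hΔ : (p : ℤ) ∣ W₀.Δ) (hc₄ : ¬ (p : ℤ) ∣ W₀.c₄) :
    (W₀.baseChange ℚ).HasMultiplicativeReductionAt v := by
  refine hasMultiplicativeReductionAt_of_valuation_c₄_eq_one (isIntegralAt_int W₀ v) ?_ ?_
  · rw [baseChange_int_c₄]; exact Rat.valuation_intCast_eq_one v (by rw [hv]; exact hc₄)
  · rw [baseChange_int_Δ]
    refine lt_of_le_of_lt (valuation_le_of_pow_dvd v hv (e := 1) (by rwa [pow_one])) ?_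
    rw [← WithZero.exp_zero]
    exact WithZero.exp_lt_exp.mpr (by norm_num)

/-- **Split multiplicative reduction is read on the integer equation mod `p`** (port to the places of
`𝓞 ℚ` and to an arbitrary integer equation of the tree's `hasSplitMultiplicativeReductionAt_iff_splits`):
at `p ∣ Δ(W₀)`, `p ∤ c₄(W₀)`, `W₀ ⊗ ℚ` has split multiplicative reduction at the place over `p` iff
the node-tangent quadratic of `W₀` splits over `𝔽_p` (model independence, Silverman VII.1.3(b);
`κ(v) ≃ ℤ/p`). [cite: SilvermanAEC2009, VII.5 Prop. 5.1(b) and VII.1 Prop. 1.3(b)] -/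
theorem hasSplitMultiplicativeReductionAt_int_iff [(W₀.baseChange ℚ).IsElliptic] {p : ℕ}
    (hv : natGenerator v = p) (hΔ : (p : ℤ) ∣ W₀.Δ) (hc₄ : ¬ (p : ℤ) ∣ W₀.c₄) :
    (W₀.baseChange ℚ).HasSplitMultiplicativeReductionAt v ↔ (nodalPoly W₀ p).Splits := by
  subst hv
  haveI : Fact (natGenerator v).Prime := ⟨prime_natGenerator v⟩
  set O := v.adicCompletionIntegers ℚ with hO
  set Y := (W₀.baseChange ℚ).baseChange (v.adicCompletion ℚ) with hY
  haveI hint : IsIntegral O Y := isIntegralAt_int W₀ v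
  haveI hmin : Y.IsMinimal O := isMinimalAt_int_of_not_dvd_c₄ (v := v) rfl hc₄
  have hΔ0 : Y.Δ ≠ 0 := by
    rw [hY, baseChange, map_Δ]
    exact (_root_.map_ne_zero _).mpr (W₀.baseChange ℚ).isUnit_Δ.ne_zero
  obtain ⟨D, hD⟩ : ∃ D : VariableChange (v.adicCompletion ℚ),
      (W₀.baseChange ℚ).localMinimalModel v = D • Y := ⟨_, rfl⟩
  have hmult : Y.HasMultiplicativeReduction O :=
    (hasMultiplicativeReduction_iff_of_isMinimal_of_eq_smul O hD hΔ0).mp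
      (hasMultiplicativeReductionAt_int (v := v) rfl hΔ hc₄)
  unfold HasSplitMultiplicativeReductionAt
  haveI := hmult
  rw [hasSplitMultiplicativeReduction_iff_of_isMinimal_of_eq_smul O hD hΔ0,
    hasSplitMultiplicativeReduction_iff]
  refine (exists_prop_of_true hmult).trans ?_
  rw [integralModel_int_adicCompletion W₀ v, nodalTangents_map, Polynomial.map_map, nodalPoly,
    nodalTangents_map]
  -- `κ(v) ≃ ℤ/p`
  set e : IsLocalRing.ResidueField O ≃+* ZMod (natGenerator v) :=
    (IsLocalRing.ResidueField.mapEquiv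
        (adicCompletionIntegers.padicIntEquiv v).toAlgEquiv.toRingEquiv).trans
      (PadicInt.residueField (p := natGenerator v)) with he
  rw [← splits_map_ringEquiv_iff e, Polynomial.map_map]
  congr! 2
  exact RingHom.ext_int _ _

/-- `ord_v Δ_min = n` for an integer equation minimal at `v` with `pⁿ ∥ Δ(W₀)` (the integral model of
`W₀ ⊗ ℚ ⊗ ℚ_v` is the cast of `W₀`; `ord_v Δ_min` is read on any minimal model, Silverman VII.1.3(b)).
[cite: SilvermanAEC2009, VII.1 Prop. 1.3(b)] -/
theorem ordMinimalDiscriminant_int_eq {p : ℕ} (hv : natGenerator v = p)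
    (hmin : (W₀.baseChange ℚ).IsMinimalAt v) {n : ℕ} (hΔ : (p : ℤ) ^ n ∣ W₀.Δ)
    (hΔ' : ¬ (p : ℤ) ^ (n + 1) ∣ W₀.Δ) : (W₀.baseChange ℚ).ordMinimalDiscriminant v = n :=
  (kodairaSymbolAt_and_ordMinimalDiscriminant_of_intModel v hv W₀ W₀ (1 : VariableChange ℤ) rfl
    (one_smul _ _).symm hmin hΔ hΔ'
    (T := (W₀.map (Int.castRingHom (v.adicCompletionIntegers ℚ))).kodairaSymbolOfMinimal)
    (fun _ _ _ ↦ rfl)).2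

end IntModel

/-! ### The node-tangent quadratic modulo `p`: roots, exhaustion, Euler witnesses -/

section Nodal

variable {W₀ : WeierstrassCurve ℤ} {p : ℕ} [Fact p.Prime]

/-- Evaluating `nodalPoly W₀ p` at the cast of an integer `t` gives the cast of
`RootNumber.nodalValue W₀ t`. [folklore] -/
theorem eval_nodalPoly_intCast (t : ℤ) :
    (nodalPoly W₀ p).eval (t : ZMod p) = (RootNumber.nodalValue W₀ t : ℤ) := by
  simp only [nodalPoly, RootNumber.nodalValue, eval_sub, eval_add, eval_mul, eval_C, eval_X, eval_pow,
    map_c₄, map_b₂, map_b₄, map_b₆, map_a₁, map_a₂, eq_intCast]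
  push_cast
  ring

/-- A root modulo `p` of the node-tangent quadratic (as an integer `t` with `p ∣ nodalValue W₀ t`) makes
it split over `𝔽_p` (`p ∤ c₄`: it has degree `2`). [folklore] -/
theorem splits_nodalPoly_of_dvd (hc₄ : ¬ (p : ℤ) ∣ W₀.c₄) {t : ℤ}
    (ht : (p : ℤ) ∣ RootNumber.nodalValue W₀ t) : (nodalPoly W₀ p).Splits := by
  refine Splits.of_degree_eq_two (Rank1Residual.IntModel.degree_nodal_eq_two W₀ p hc₄)
    (x := (t : ZMod p)) ?_
  rw [eval_nodalPoly_intCast]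
  exact (ZMod.intCast_zmod_eq_zero_iff_dvd _ p).mpr ht

/-- If the node-tangent quadratic splits over `𝔽_p` (`p ∤ c₄`) then some `t < p` has
`p ∣ nodalValue W₀ t`. [folklore] -/
theorem exists_dvd_nodalValue_of_splits (hc₄ : ¬ (p : ℤ) ∣ W₀.c₄) (hs : (nodalPoly W₀ p).Splits) :
    ∃ t : ℕ, t < p ∧ (p : ℤ) ∣ RootNumber.nodalValue W₀ t := by
  obtain ⟨x, hx⟩ := hs.exists_eval_eq_zero
    (by rw [show (nodalPoly W₀ p).degree = 2 from Rank1Residual.IntModel.degree_nodal_eq_two W₀ p hc₄]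
        decide)
  refine ⟨x.val, ZMod.val_lt x, ?_⟩
  have hx' : (nodalPoly W₀ p).eval (((x.val : ℕ) : ℤ) : ZMod p) = 0 := by
    rw [Int.cast_natCast, ZMod.natCast_zmod_val]; exact hx
  rw [eval_nodalPoly_intCast] at hx'
  exact (ZMod.intCast_zmod_eq_zero_iff_dvd _ p).mp hx'

/-- **Non-split by exhaustion**: if no `t < p` has `p ∣ nodalValue W₀ t` then the node-tangent quadratic
does not split over `𝔽_p`. [folklore] -/
theorem not_splits_nodalPoly_of_forall (hc₄ : ¬ (p : ℤ) ∣ W₀.c₄)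
    (h : ∀ t : ℕ, t < p → ¬ (p : ℤ) ∣ RootNumber.nodalValue W₀ t) : ¬ (nodalPoly W₀ p).Splits :=
  fun hs ↦ by obtain ⟨t, ht, hd⟩ := exists_dvd_nodalValue_of_splits hc₄ hs; exact h t ht hd

/-- **Non-split by Euler's criterion** (`p` odd): if the discriminant `d = RootNumber.nodalDisc W₀` of the
node-tangent quadratic satisfies `d^{(p−1)/2} = −1` in `ℤ/p`, then `d` is a non-residue and the quadratic
has no root modulo `p` (port of the cell's `localRootNumberAt_eq_one_of_pow_eq_neg_one`). [folklore] -/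
theorem not_splits_nodalPoly_of_euler (hc₄ : ¬ (p : ℤ) ∣ W₀.c₄) (h2 : p ≠ 2)
    (heuler : ((RootNumber.nodalDisc W₀ : ℤ) : ZMod p) ^ (p / 2) = -1) :
    ¬ (nodalPoly W₀ p).Splits := by
  have hp : p.Prime := Fact.out
  haveI : Fact (2 < p) := ⟨lt_of_le_of_ne hp.two_le (Ne.symm h2)⟩
  intro hs
  obtain ⟨t, ht⟩ := hs.exists_eval_eq_zero
    (by rw [show (nodalPoly W₀ p).degree = 2 from Rank1Residual.IntModel.degree_nodal_eq_two W₀ p hc₄]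
        decide)
  simp only [nodalPoly, eval_sub, eval_add, eval_mul, eval_C, eval_X, eval_pow, map_c₄, map_b₂, map_b₄,
    map_b₆, map_a₁, map_a₂, eq_intCast] at ht
  have hsq : IsSquare ((RootNumber.nodalDisc W₀ : ℤ) : ZMod p) := by
    refine ⟨2 * (W₀.c₄ : ZMod p) * t + (W₀.a₁ * W₀.c₄ : ℤ), ?_⟩
    have hd := discrim_eq_sq_of_quadratic_eq_zero (a := (W₀.c₄ : ZMod p))
      (b := ((W₀.a₁ * W₀.c₄ : ℤ) : ZMod p))
      (c := -((54 * W₀.b₆ - 3 * W₀.b₂ * W₀.b₄ + W₀.a₂ * W₀.c₄ : ℤ) : ZMod p))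
      (x := t) (by push_cast; linear_combination ht)
    rw [discrim] at hd
    simp only [RootNumber.nodalDisc]
    push_cast at hd ⊢
    linear_combination hd
  have hne : ((RootNumber.nodalDisc W₀ : ℤ) : ZMod p) ≠ 0 := by
    intro h0
    rw [h0, zero_pow (Nat.div_pos hp.two_le two_pos).ne'] at heuler
    exact one_ne_zero (neg_eq_zero.mp heuler.symm)
  rw [ZMod.euler_criterion p hne] at hsq
  rw [hsq] at heuler
  exact ZMod.neg_one_ne_one heuler.symm

end Nodal

/-! ### The proved value sets of the additive Kodaira types -/

/-- The set of values of `c_v` the TREE PROVES for an additive Kodaira type (Silverman *ATAEC* IV.9.4,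
Steps 3–10: `II ↦ 1`, `III ↦ 2`, `IV ↦ 1 or 3`, `I₀* ↦ 1, 2 or 4`, `Iₙ* ↦ 2 or 4`, `IV* ↦ 1 or 3`,
`III* ↦ 2`, `II* ↦ 1`); empty on the semistable types (not used). [cite: SilvermanATAEC1994, IV.9.4] -/
def kodairaVals : KodairaSymbol → List ℕ
  | .II => [1]
  | .III => [2]
  | .IV => [1, 3]
  | .Istar 0 => [1, 2, 4]
  | .Istar (_ + 1) => [2, 4]
  | .IVstar => [1, 3]
  | .IIIstar => [2]
  | .IIstar => [1]
  | .I _ => []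

/-- **`c_v` lies in the proved value set of its additive Kodaira type** — the conjunction of the
tree's nine discharged Tate-step facts. [cite: SilvermanATAEC1994, IV.9.4 Steps 3–10] -/
theorem tam_mem_kodairaVals {W₀ : WeierstrassCurve ℤ} [(W₀.baseChange ℚ).IsElliptic]
    (v : HeightOneSpectrum (𝓞 ℚ)) {T : KodairaSymbol} (hT : (W₀.baseChange ℚ).kodairaSymbolAt v = T)
    (hne : kodairaVals T ≠ []) : tam W₀ v ∈ kodairaVals T := by
  haveI := perfectField_residueField_adicCompletionIntegers (K := ℚ) v
  cases T with
  | I n => exact absurd rfl hne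
  | II => simpa [kodairaVals] using
      localTamagawaNumber_eq_one_of_kodairaSymbolAt_eq_II_holds v (W₀.baseChange ℚ) hT
  | III => simpa [kodairaVals] using
      localTamagawaNumber_eq_two_of_kodairaSymbolAt_eq_III_holds v (W₀.baseChange ℚ) hT
  | IV => simpa [kodairaVals] using
      localTamagawaNumber_of_kodairaSymbolAt_eq_IV_holds v (W₀.baseChange ℚ) hT
  | Istar n =>
    cases n with
    | zero => simpa [kodairaVals] using
        localTamagawaNumber_of_kodairaSymbolAt_eq_Istar_zero_holds v (W₀.baseChange ℚ) hT
    | succ m => simpa [kodairaVals] using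
        localTamagawaNumber_of_kodairaSymbolAt_eq_Istar_succ_holds v (W₀.baseChange ℚ) m hT
  | IVstar => simpa [kodairaVals] using
      localTamagawaNumber_of_kodairaSymbolAt_eq_IVstar_holds v (W₀.baseChange ℚ) hT
  | IIIstar => simpa [kodairaVals] using
      localTamagawaNumber_eq_two_of_kodairaSymbolAt_eq_IIIstar_holds v (W₀.baseChange ℚ) hT
  | IIstar => simpa [kodairaVals] using
      localTamagawaNumber_eq_one_of_kodairaSymbolAt_eq_IIstar_holds v (W₀.baseChange ℚ) hT

end Summit.BirchSwinnertonDyer.BirchSwinnertonDyer.Rank2Observatory.Tam
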